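/-
Origin: expansion seat `prover-pub-hodgecm-mc-discharge-4-g6-0`, handover #2 17:00Z md5 c076bd1893cb (125 l.; NEW additive KERNEL leaf, ns HodgeCM.Model.HypCensus; imports `HodgeCM.Model.HypCensus.DefiniteVacuumExponent` (row #1) only; 0 defs / 0 records / 0 cited hypotheses, 2 theorems: `eq_cmPlaceOver_of_comap` (the complex place of `L` over a real place `b` of `L⁺` is unique: a consumer-named `w` with `w.1.comap (algebraMap L⁺ L) = b.1` IS `cmPlaceOver L b` — `subst` bridge to row #1's statements) and **`exists_exponent_twist_eq_self_of_signs_one`** (row #1's headline at `M = 1`, `e : Fin N × Fin 1 ≃ Fin n`, `dW : Fin 1 → L`: binders `(ι₁ hGR h₁V hV)` ONLY — no hypothesis on the hermitian line, via `signs_fin_one` / `signs_fin_one'`; this is the form the S-term's small pairs `(U(V), U(W_k))` consume). MODEL-N ±0, E unchanged. EVIDENCE: hub-farm `lean check` rc 0 / 0 sorries / 0 warnings, 62 s, of `mc/pub-hodgecm-mc-discharge-4/stage/g6/check_c5_concat2.lean` d294f20c8598 (2493 l. = row #1's import-form concat 034e21a33a68 ++ this body; log `stage/g6/check_c5_concat.log`);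 `#print axioms` of both decls = [propext, Classical.choice, Quot.sound].) (`HOME/mc/pub-hodgecm-mc-discharge-4/stage/HodgeCM/Model/HypCensus/DefiniteVacuumExponentLines.lean`, md5 c076bd18, 125 lines);
landed by the gen-12 packager (p-g12) in gate run 36 as `HodgeCM/Model/HypCensus/DefiniteVacuumExponentLines.lean` (verbatim).
-/
/-
Origin: speedrun cell pub-hodgecm, MODEL-CONSTRUCTION sub-cell, discharge seat mc-discharge-4 (unit pub-hodgecm-mc-discharge-4,
seat prover-pub-hodgecm-mc-discharge-4-g6-0, gen 6), ticket D-5 sub-item (c5) = (C-fix∞⊥) under (S-norm)/(η-split): SIBLING of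
`HypCensus/DefiniteVacuumExponent.lean` (kit row #2), authored under binder-2's custody (CUSTODY WORD STATUS 2026-08-19T13:37:10Z),
2026-08-19.  Target in PKG: `HodgeCM/Model/HypCensus/DefiniteVacuumExponentLines.lean` (NEW additive leaf; imports row #1 only).
KERNEL only: 0 definitions / records / named facts / cited hypotheses, 0 proof holes.  Checked against the hub tree by the same
concatenation as row #1 (++ row #1's body ++ this body), farm rc 0.
-/
import Summits.HodgeConjecture.HodgeCM.Model.HypCensus.DefiniteVacuumExponent_2

/-!
# Census kit, sub-item (c5): the LINE pairs of the `S`-term (`M = 1`) and a consumer-named place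

The consumers of (c5) are the two small pairs `(U(V), U(W_k))`, `W_k = ⟨d⟩` a hermitian LINE, of the RUN-37 `S`-term
((S-restr): `(S V c).P k` is the renormalised small pair; (η-split): its normalising character `ν⁽ᵏ⁾` has archimedean type
`−e_b` at each definite `b`).  For a line NO sign hypothesis on `W` is needed (`signs_fin_one`, `signs_fin_one'`), so the
headline of row #1 specialises to the binders `(ι₁ hGR h₁V hV)` — `V` of signature `(N−1,1)`/`(1,N−1)` through `ι₁` and definite
through every other complex embedding, i.e. the `V`-half of unitary-1's `wmInputCM₂s`:

* `eq_cmPlaceOver_of_comap` — the complex place of the CM field `L` over a real place `b` of `L⁺` is unique: a consumer's own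
  name `w` for it IS `cmPlaceOver L b` (`subst` and apply the theorems, which are stated at `cmPlaceOver L b`);
* **`exists_exponent_twist_eq_self_of_signs_one`** — (c5) for a line pair: ONE raw-exponent function `a : {v real} → ℤ` such
  that every normalisation `s_pair ⊗ ((χ_V∘det_V) ⊠ (χ_W∘det_W))` with `χ_V` of archimedean type `n_V`, `n_V (w(b)) = −a b`, FIXES
  every pure tensor `E(Φ_∞ ⊗ Φ_f)` whose archimedean factor is the vacuum at the definite place `b` (canonical-frame image `B⁻¹G`,
  `G` free of `b`) under every one-place element `((archSingle (w b) u)^𝔸, 1)`.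

Nothing here is a claim of PerL/QW8.  Provenance as row #1: [KonnoKonno2007, §3.1 (3.1)], [Folland1989, Prop. (4.39)],
[GelbartRogawski1991, §3.1 Prop. 3.1.1 p. 455, Remark p. 457 L4–13], [BorelJacquet1979, §4.1].
-/

set_option autoImplicit false

noncomputable section

open NumberField NumberField.InfinitePlace IsDedekindDomain
open scoped Matrix
open scoped Classical TensorProduct
open Literature.NumberTheory.Automorphic Literature.NumberTheory.Automorphic.UnitaryGroup Literature.NumberTheory.Weil1964
open Literature.RepresentationTheory.KonnoKonno2007 Literature.RepresentationTheory.KonnoKonno2007.RealDualPair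
open Literature.NumberTheory.GelbartRogawski1991 Literature.NumberTheory.GelbartRogawski1991.UnitaryDualPair
open Literature.Analysis.SegalBargmann

namespace HodgeCM.Model.HypCensus

/-! ## §1 The complex place over a real place of `L⁺` is unique -/

section Place

variable (L : Type) [Field L] [NumberField L] [IsCMField L]

/-- **The complex place of `L` over a real place `b` of `L⁺` is unique**: any complex place `w` of `L` with `w|_{L⁺} = b` IS the
chosen one `cmPlaceOver L b` (`IsCMField.equivInfinitePlace`; `cmPlaceOver_eq_mk` of the tree). [folklore] -/
theorem eq_cmPlaceOver_of_comap (b : {v : InfinitePlace ↥(maximalRealSubfield L) // v.IsReal})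
    (w : {w : InfinitePlace L // w.IsComplex}) (hw : w.1.comap (algebraMap (↥(maximalRealSubfield L)) L) = b.1) :
    w = cmPlaceOver L b :=
  Subtype.ext ((cmPlaceOver_eq_mk L b w.1.embedding (by rw [mk_embedding]; exact hw)).trans (mk_embedding w.1)).symm

end Place

/-! ## §2 (c5) for a LINE pair `(U(diag d_V), U(⟨d⟩))` -/

section LinePair

variable (L : Type) [Field L] [NumberField L] [IsCMField L] {N n : ℕ} (e : Fin N × Fin 1 ≃ Fin n)
variable (dV : Fin N → L) (hdV : ∀ i, IsCMField.complexConj L (dV i) = dV i) (hdV0 : ∀ i, dV i ≠ 0)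
variable (dW : Fin 1 → L) (hdW : ∀ i, IsCMField.complexConj L (dW i) = dW i) (hdW0 : ∀ i, dW i ≠ 0)
variable (hGR : (cmSplittingDatum L e dV hdV hdV0 dW hdW hdW0).CompatibleSplitting)

/-- **(c5) = (C-fix∞⊥) UNDER (S-norm) FOR A LINE PAIR, FROM THE SIGN FACTS OF `V` ALONE.**  For the CM dual pair
`(U(diag d_V), U(⟨d_W 0⟩))` over `L/L⁺` with its compatible splitting ([GelbartRogawski1991, Prop. 3.1.1]) and `V` of signature
`(N−1,1)`/`(1,N−1)` through `ι₁`, definite through every other complex embedding: there is ONE raw-exponent function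
`a : {v real} → ℤ` such that for all unitary line characters `χ_V, χ_W` with `χ_V` of archimedean type `n_V` and every real place `b`
NOT under `ι₁` with `n_V (w(b)) = −a b`, the normalised Weil action of every one-place element `((archSingle (w b) u)^𝔸, 1)` FIXES
every pure tensor `E(Φ_∞ ⊗ Φ_f)` whose archimedean factor is the vacuum at `b` (canonical-frame image `B⁻¹G`, `G` free of `b`).
Row #1's `exists_exponent_twist_eq_self_of_signs` with `h₁W := signs_fin_one …`, `hW := signs_fin_one'` (a line is definite everywhere).
[KonnoKonno2007, §3.1 (3.1); Folland1989, §4.2 (4.24) p. 156, Prop. (4.39); Knapp2002, Thm 7.39; GelbartRogawski1991, §3.1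
Prop. 3.1.1 p. 455, Remark p. 457 L4–13; MoeglinVignerasWaldspurger1987, Ch. 1 I.17; Weil1964, Chap. III n° 37–39;
BorelJacquet1979, §4.1] -/
theorem exists_exponent_twist_eq_self_of_signs_one (ι₁ : L →+* ℂ)
    (h₁V : ∃ i₀ : Fin N, (∀ i, i ≠ i₀ → 0 < (ι₁ (dV i)).re) ∨ ∀ i, i ≠ i₀ → (ι₁ (dV i)).re < 0)
    (hV : ∀ τ : L →+* ℂ, InfinitePlace.mk τ ≠ InfinitePlace.mk ι₁ →
      (∀ i, 0 < (τ (dV i)).re) ∨ ∀ i, (τ (dV i)).re < 0) :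
    ∃ a : {v : InfinitePlace ↥(maximalRealSubfield L) // v.IsReal} → ℤ,
      ∀ (χV χW : ContinuousMonoidHom
          (relNormOneIdeles (↥(maximalRealSubfield L)) L ⧸ relNormOneRat (↥(maximalRealSubfield L)) L) Circle)
        (nV : InfinitePlace L → ℤ), UnitaryLineChar.HasArchType L χV nV →
        ∀ b : {v : InfinitePlace ↥(maximalRealSubfield L) // v.IsReal},
          b.1 ≠ (InfinitePlace.mk ι₁).comap (algebraMap (↥(maximalRealSubfield L)) L) →
          nV (cmPlaceOver L b).1 = -a b →
            ∀ (G : MvPolynomial (Fin n × {v : InfinitePlace ↥(maximalRealSubfield L) // v.IsReal}) ℂ),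
              (∀ x ∈ G.vars, x.2 ≠ b) →
                ∀ Φinf : SchwartzMap (Fin n → mixedEmbedding.mixedSpace (↥(maximalRealSubfield L))) ℂ,
                  schwartzTransport
                      (scaledFrame (↥(maximalRealSubfield L)) (Fin n)
                        (pairScale N 1 (e := e)
                          (fun v => sqrtAbs (placeSignVec (cmRealVec L dV hdV) (cmSignConv L dV ι₁) v))
                          (fun v => sqrtAbs (placeSignVec (cmRealVec L dW hdW) (fun v =>
                            ((cmPlaceOver L v).1.embedding (imagUnit L)).im / cmSignConv L dV ι₁ v) v)))
                        (pairScale_ne_zero N 1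
                          (fun v i => sqrtAbs_ne_zero (div_ne_zero ((map_ne_zero _).2 (ne_zero_of_isUnit_det_diagonal
                            (isUnit_det_realDiagonal L dV hdV hdV0) i)) (cmSignConv_ne_zero L dV ι₁ v)))
                          (fun v j => sqrtAbs_ne_zero (div_ne_zero ((map_ne_zero _).2 (ne_zero_of_isUnit_det_diagonal
                            (isUnit_det_realDiagonal L dW hdW hdW0) j))
                            (div_ne_zero (im_embedding_cmPlaceOver_imagUnit_ne_zero L v)
                              (cmSignConv_ne_zero L dV ι₁ v))))))
                      Φinf = binvPi G →
                    ∀ (f : FinSB (↥(maximalRealSubfield L)) (Fin n))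
                      (u : archLocal L N (Matrix.diagonal dV) (cmPlaceOver L b)),
                      cmPairRepTwist L e dV hdV hdV0 dW hdW hdW0 hGR
                          (cmDetTwistChar L dV hdV0 dW hdW0 (charOfUnitaryLineChar L χV) (charOfUnitaryLineChar L χW))
                          (archToAdelic (↥(maximalRealSubfield L)) L (IsCMField.complexConj L) N (Matrix.diagonal dV)
                            (archSingle (↥(maximalRealSubfield L)) L (IsCMField.complexConj L) N (Matrix.diagonal dV)
                              (IsCMField.complexConj_ne_one L) (complexConj_smul_infinitePlace L) (cmPlaceOver L b) u),
                            1)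
                          (piSchwartzBruhatEquiv (↥(maximalRealSubfield L)) (Fin n) (Φinf ⊗ₜ[ℂ] f)) =
                        piSchwartzBruhatEquiv (↥(maximalRealSubfield L)) (Fin n) (Φinf ⊗ₜ[ℂ] f) :=
  exists_exponent_twist_eq_self_of_signs L e dV hdV hdV0 dW hdW hdW0 hGR ι₁ h₁V
    (signs_fin_one fun j => re_apply_ne_zero_of_complexConj_eq L ι₁ (hdW j) (hdW0 j)) hV
    fun _ _ => signs_fin_one' _

end LinePair

end HodgeCM.Model.HypCensus

end
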